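import Literature.NumberTheory.LFunctions.LSeriesContinuationOfPartialSums
import HarnessLib

/-!
# Reflection symmetry of the continuation from partial sums for real coefficients

A complement to `LSeriesContinuationOfPartialSums` (`contF a s = s · 𝓜(E)(−s)`, the continuation of
`L(a, s)` from the partial sums of `a`): when the coefficients `a` are real,
`contF a (s̄) = conj (contF a s)` (`contF_conj`), so the zeros of the continued `L`-function are
symmetric under complex conjugation — the field `reflect` of `TwistedZFRData` for real (quadratic)
characters (T. Mitsui's prime number theorem with Grössencharakteren; Heath-Brown 2001, Lemma 9.4,
"quadratic characters are a potential problem"). Everything is PROVED; no definitions.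

## References

* H. L. Montgomery, R. C. Vaughan, *Multiplicative Number Theory I*, CUP 2007, §10.1 (reflection for
  real characters, `L(s̄, χ) = conj L(s, χ)`). [cite: MontgomeryVaughan2007, §10.1]
* D. R. Heath-Brown, *Primes represented by `x³ + 2y³`*, Acta Math. 186 (2001), §9 p. 55. [cite: HeathBrownActa2001, §9 Lemma 9.4]

## Mathlib / tree search

Tree: `PartialSumContinuation.contF/partialSum/errorTerm/errorTermC`; `Barriers.RiemannHypothesis.mellin_conj`
(same Mellin fact, on an unrelated import branch — re-proved inline). Mathlib: `mellin`,
`integral_conj`, `Complex.cpow_conj`, `Complex.arg_ofReal_of_nonneg`, `setIntegral_congr_fun`.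
-/

noncomputable section

open Complex MeasureTheory Set Finset
open scoped ComplexConjugate

namespace Literature.NumberTheory.LFunctions.PartialSumContinuation

variable {a : ℕ → ℂ}

/-- Partial sums of real coefficients are real. [folklore] -/
theorem conj_partialSum (ha : ∀ n, conj (a n) = a n) (t : ℝ) : conj (partialSum a t) = partialSum a t := by
  rw [partialSum, map_sum]
  exact Finset.sum_congr rfl fun n _ ↦ ha n

/-- The error term (no pole) of real coefficients is real. [folklore] -/
theorem conj_errorTermC (ha : ∀ n, conj (a n) = a n) (t : ℝ) : conj (errorTermC a 0 t) = errorTermC a 0 t := by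
  rw [errorTermC, Set.indicator_apply]
  split_ifs
  · rw [errorTerm, zero_mul, sub_zero, conj_partialSum ha]
  · exact map_zero _

/-- **Reflection**: for real coefficients, `contF a (s̄) = conj (contF a s)` (the Mellin transform
of the real error term commutes with conjugation; cf. the tree's
`Barriers.RiemannHypothesis.mellin_conj`, not imported here). [cite: MontgomeryVaughan2007, §10.1] -/
theorem contF_conj (ha : ∀ n, conj (a n) = a n) (s : ℂ) : contF a (conj s) = conj (contF a s) := by
  have hmellin : ∀ z : ℂ, mellin (errorTermC a 0) (conj z) = conj (mellin (errorTermC a 0) z) := by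
    intro z
    rw [mellin, mellin, ← integral_conj]
    refine setIntegral_congr_fun measurableSet_Ioi fun t ht ↦ ?_
    have ht0 : 0 < t := ht
    have harg : ((t : ℂ)).arg ≠ Real.pi := by
      rw [Complex.arg_ofReal_of_nonneg ht0.le]; exact Real.pi_ne_zero.symm
    rw [smul_eq_mul, smul_eq_mul, map_mul, conj_errorTermC ha, show conj z - 1 = conj (z - 1) by simp,
      Complex.cpow_conj _ _ harg, Complex.conj_ofReal]
  rw [contF, contF, map_mul, ← map_neg, hmellin]

/-- **Zeros of the continuation of a real Dirichlet series are symmetric**: `contF a ρ = 0` iff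
`contF a ρ̄ = 0`. [cite: MontgomeryVaughan2007, §10.1] -/
theorem contF_conj_eq_zero_iff (ha : ∀ n, conj (a n) = a n) (ρ : ℂ) :
    contF a (conj ρ) = 0 ↔ contF a ρ = 0 := by
  rw [contF_conj ha, map_eq_zero]

end Literature.NumberTheory.LFunctions.PartialSumContinuation
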